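import Mathlib
import HarnessLib
import Summits.HubbardSuperconductivity.HubbardSuperconductivity.Theorems.KLProgrammeKLRegimeVolumeLimitHartree

/-!
# The VL carrier at FINITE Matsubara cutoff is EXACTLY a connected expectation of field derivatives of the interaction:
# `Σ̂^K_{L,M}(k,σ;U) = −βL²·⟨∂⁺_{kσ}∂⁻_{kσ}V_K − (∂⁺_{kσ}V_K)(∂⁻_{kσ}V_K)⟩_{C^K, V_K}` (Schwinger–Dyson at cutoff `M`; seat hubbard-kl-k3c5-p2, g2)

Route `KLProgramme`, child 5 `KLRegimeVolumeLimitV11` (stmt-HubbardSuperconductivity-19826), clause (i) of `FinalTwoLegVolLimit`.  The `M = ∞` results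
of `…ThermalGreenHubbardTorusExact` (`(ĝ − 𝒢)(−ik₀+ξ)² = U⟨{T,c†}⟩ − U²𝒵`, `O(U)` uniformly) came from two integrations by parts in the
imaginary time.  At FINITE cutoff `M` the same two steps are Grassmann integrations by parts (`gaussExpect_psiPlus_mul` /
`gaussExpect_psiMinus_mul`, `…VolumeLimitHartree`) and give an EXACT identity for the very carrier of the VL text, for EVERY coupling, EVERY frame
and EVERY volume `(L, M)` at which the bare normalised partition function does not vanish:

* `gaussExpect_genPair_dyson` — for the Hubbard covariance `C^K` (seed `0`, `β ≠ 0`) and ANY even nilpotent `V`: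
  `∫dμ_{C^K} ψ̂⁺_{kσ}ψ̂⁻_{kσ} e^{−V} + βL²ĝ_K(k)·∫dμ_{C^K} e^{−V} = −(βL²ĝ_K(k))²·∫dμ_{C^K} e^{−V}·(∂⁺_{kσ}∂⁻_{kσ}V − ∂⁺_{kσ}V·∂⁻_{kσ}V)`;
* `klSelfEnergy_nScales_succ_eq_dyson` — with `V_K = hubbardInteractionCT L M β U K`, `Z_K = ∫dμ_{C^K}e^{−V_K}` and the bare `D_{L,M}(U) ≠ 0`:
  `klSelfEnergy L M β U μ K klE0 (nScales β + 1) k σ = −(βL²/Z_K)·∫dμ_{C^K} e^{−V_K}·(∂⁺_{kσ}∂⁻_{kσ}V_K − ∂⁺_{kσ}V_K·∂⁻_{kσ}V_K)`.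

So clause (i) of the VL text is, at every admissible volume, a bound on ONE normalised composite expectation (`∂⁺∂⁻V_K` is quadratic — the Hartree /
frame term —, `∂⁺V_K·∂⁻V_K` is the product of two cubic "currents": the finite-`M` twin of `U⟨{T,c†}⟩ − U²𝒵`); what carries it to `M = ∞` is the
τ-resolved all-`U` Matsubara limit for that composite insertion (TAU-BRIDGE.md §5).  Everything is proved; no definition.
-/

noncomputable section

namespace Summit.HubbardSuperconductivity.HubbardSuperconductivity.Theorems.TwoPointAssembly

set_option linter.dupNamespace false -- summit = problem name (single-conjunct summit), D-0017

open Finset Literature.MathematicalPhysics.QuantumLattice Literature.Probability.LatticeModels GrassmannAlgebra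
open Summit.HubbardSuperconductivity.HubbardSuperconductivity.Theorems.KLRegimeSplit
open Summit.HubbardSuperconductivity.HubbardSuperconductivity.Theorems.KLProgrammeLegKernels

variable {L M : ℕ} [NeZero L]

/-- **SCHWINGER–DYSON AT FINITE CUTOFF (two Grassmann integrations by parts).**  For the Hubbard covariance in the frame `K` (seed `0`, `β ≠ 0`),
a frequency–momentum `k`, a spin `σ` and ANY even nilpotent `V`:
`∫ψ̂⁺_{kσ}ψ̂⁻_{kσ}e^{−V} + βL²ĝ_K(k)·∫e^{−V} = −(βL²ĝ_K(k))²·∫e^{−V}(∂⁺_{kσ}∂⁻_{kσ}V − ∂⁺_{kσ}V·∂⁻_{kσ}V)`. -/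
theorem gaussExpect_genPair_dyson {β : ℝ} (hβ : β ≠ 0) (μ : ℝ) (K : TrigPolyC4v) (k : FreqMomentum L M) (σ : Fin 2)
    {V : HubbardGrassmann L M} (hV : V ∈ evenOdd ℂ 0) (hVn : IsNilpotent V) :
    gaussExpect ℂ (hubbardCovarianceCT L M β μ 0 K)
          (gen ℂ (((k, σ), 0) : HubbardFieldIdx L M) * gen ℂ (((k, σ), 1) : HubbardFieldIdx L M) * grassmannExp (-V)) +
        ((β * (L : ℝ) ^ 2 : ℝ) : ℂ) * propCT L M β μ K k * gaussExpect ℂ (hubbardCovarianceCT L M β μ 0 K) (grassmannExp (-V)) =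
      -(((β * (L : ℝ) ^ 2 : ℝ) : ℂ) * propCT L M β μ K k) ^ 2 *
        gaussExpect ℂ (hubbardCovarianceCT L M β μ 0 K)
          (grassmannExp (-V) *
            (grassmannDeriv ℂ (((k, σ), 0) : HubbardFieldIdx L M) (grassmannDeriv ℂ (((k, σ), 1) : HubbardFieldIdx L M) V) -
              grassmannDeriv ℂ (((k, σ), 0) : HubbardFieldIdx L M) V * grassmannDeriv ℂ (((k, σ), 1) : HubbardFieldIdx L M) V)) := by
  set a : HubbardFieldIdx L M := ((k, σ), 0) with ha
  set b : HubbardFieldIdx L M := ((k, σ), 1) with hb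
  set C := hubbardCovarianceCT L M β μ 0 K with hC
  set g : ℂ := ((β * (L : ℝ) ^ 2 : ℝ) : ℂ) * propCT L M β μ K k with hg
  set E : HubbardGrassmann L M := grassmannExp (-V) with hE
  have hVneg : -V ∈ evenOdd ℂ 0 := neg_mem hV
  have hVnegn : IsNilpotent (-V) := hVn.neg
  have hEeven : E ∈ evenOdd ℂ 0 := grassmannExp_mem_evenOdd_zero ℂ hVneg hVnegn
  -- `∂_X e^{−V} = −(e^{−V} · ∂_X V)`
  have hdE : ∀ X : HubbardFieldIdx L M, grassmannDeriv ℂ X E = -(E * grassmannDeriv ℂ X V) := by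
    intro X
    rw [hE, grassmannDeriv_grassmannExp_of_mem_evenOdd_zero ℂ X hVneg hVnegn, map_neg, mul_neg]
  -- step 1: integrate `ψ̂⁺_{kσ}` by parts
  have h1 : gaussExpect ℂ C (gen ℂ a * gen ℂ b * E) = -g * gaussExpect ℂ C E - g * gaussExpect ℂ C (gen ℂ b * (E * grassmannDeriv ℂ b V)) := by
    rw [mul_assoc, hC, ha, gaussExpect_psiPlus_mul hβ μ K k σ, ← hC, ← hb, grassmannDeriv_gen_mul, if_pos rfl, hdE b, mul_neg, sub_neg_eq_add,
      map_add, ← hg]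
    ring
  -- step 2: integrate `ψ̂⁻_{kσ}` by parts
  have h2 : gaussExpect ℂ C (gen ℂ b * (E * grassmannDeriv ℂ b V)) =
      g * gaussExpect ℂ C (E * (grassmannDeriv ℂ a (grassmannDeriv ℂ b V) - grassmannDeriv ℂ a V * grassmannDeriv ℂ b V)) := by
    rw [hC, hb, gaussExpect_psiMinus_mul hβ μ K k σ, ← hC, ← ha, ← hg, grassmannDeriv_mul_of_mem_evenOdd_zero ℂ a hEeven, hdE a]
    congr 1
    congr 1
    noncomm_ring
  rw [h1, h2]
  ring

/-- **THE VL CARRIER AT FINITE CUTOFF, EXACTLY.**  For `β > 0`, any `U, μ`, any frame `K`, any volume `(L, M)` with bare normalised partition function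
`D_{L,M}(U) ≠ 0`, every `k`, `σ`:
`klSelfEnergy L M β U μ K klE0 (nScales β + 1) k σ = −(βL² / Z_K)·∫dμ_{C^K} e^{−V_K}(∂⁺_{kσ}∂⁻_{kσ}V_K − ∂⁺_{kσ}V_K·∂⁻_{kσ}V_K)`,
`V_K = hubbardInteractionCT L M β U K`, `Z_K = effPartitionFn ℂ C^K V_K`. -/
theorem klSelfEnergy_nScales_succ_eq_dyson {β : ℝ} (hβ : 0 < β) (U μ : ℝ) (K : TrigPolyC4v) (k : FreqMomentum L M) (σ : Fin 2)
    (hD : effPartitionFn ℂ (hubbardCovariance L M β μ 0) (hubbardInteraction L M β U) ≠ 0) :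
    klSelfEnergy L M β U μ K klE0 (nScales β + 1) k σ =
      -(((β * (L : ℝ) ^ 2 : ℝ) : ℂ) / effPartitionFn ℂ (hubbardCovarianceCT L M β μ 0 K) (hubbardInteractionCT L M β U K)) *
        gaussExpect ℂ (hubbardCovarianceCT L M β μ 0 K)
          (grassmannExp (-(hubbardInteractionCT L M β U K)) *
            (grassmannDeriv ℂ (((k, σ), 0) : HubbardFieldIdx L M)
                (grassmannDeriv ℂ (((k, σ), 1) : HubbardFieldIdx L M) (hubbardInteractionCT L M β U K)) -
              grassmannDeriv ℂ (((k, σ), 0) : HubbardFieldIdx L M) (hubbardInteractionCT L M β U K) *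
                grassmannDeriv ℂ (((k, σ), 1) : HubbardFieldIdx L M) (hubbardInteractionCT L M β U K))) := by
  have hβ0 : β ≠ 0 := hβ.ne'
  have hβL : ((β * (L : ℝ) ^ 2 : ℝ) : ℂ) ≠ 0 := by
    have hL : (L : ℝ) ≠ 0 := by exact_mod_cast NeZero.ne L
    exact_mod_cast mul_ne_zero hβ0 (pow_ne_zero 2 hL)
  have hg0 := propCT_ne_zero (L := L) (M := M) hβ0 μ K k
  set C := hubbardCovarianceCT L M β μ 0 K with hC
  set VK := hubbardInteractionCT L M β U K with hVK
  set ZK0 : ℂ := gaussExpect ℂ C (grassmannExp (-(counterQuadratic L M β K))) with hZK0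
  have hZK0ne : ZK0 ≠ 0 := gaussExpect_counterQuadratic_ne_zero β μ 0 K hβ0
  -- the frame-`K` numerator and partition function are `ZK0` times the bare ones
  have hN : gaussExpect ℂ C (gen ℂ (((k, σ), 0) : HubbardFieldIdx L M) * gen ℂ (((k, σ), 1) : HubbardFieldIdx L M) * grassmannExp (-VK)) =
      ZK0 * gaussExpect ℂ (hubbardCovariance L M β μ 0)
        (gen ℂ (((k, σ), 0) : HubbardFieldIdx L M) * gen ℂ (((k, σ), 1) : HubbardFieldIdx L M) *
          grassmannExp (-(hubbardInteraction L M β U))) := by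
    rw [hC, hVK, hZK0]; exact gaussExpect_CT_genPair_eq_mul_bare hβ0 U μ K _ _
  have hZ : effPartitionFn ℂ C VK = ZK0 * effPartitionFn ℂ (hubbardCovariance L M β μ 0) (hubbardInteraction L M β U) := by
    rw [hC, hVK, hZK0]; exact effPartitionFn_CT_eq_mul_bare hβ0 U μ K
  have hZne : effPartitionFn ℂ C VK ≠ 0 := by rw [hZ]; exact mul_ne_zero hZK0ne hD
  -- the frame reduction `c ĝ² Σ̂ = N_bare/D_bare + c ĝ` and `N_bare/D_bare = N_K/Z_K`
  have hred := klSelfEnergy_nScales_succ_frame_reduction hβ U μ K k σ hD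
  have hratio : gaussExpect ℂ (hubbardCovariance L M β μ 0)
        (gen ℂ (((k, σ), 0) : HubbardFieldIdx L M) * gen ℂ (((k, σ), 1) : HubbardFieldIdx L M) *
          grassmannExp (-(hubbardInteraction L M β U))) /
        effPartitionFn ℂ (hubbardCovariance L M β μ 0) (hubbardInteraction L M β U) =
      gaussExpect ℂ C (gen ℂ (((k, σ), 0) : HubbardFieldIdx L M) * gen ℂ (((k, σ), 1) : HubbardFieldIdx L M) * grassmannExp (-VK)) /
        effPartitionFn ℂ C VK := by
    rw [hN, hZ, mul_div_mul_left _ _ hZK0ne]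
  rw [hratio] at hred
  -- the Dyson identity for `V_K`
  have hdy := gaussExpect_genPair_dyson hβ0 μ K k σ (hubbardInteractionCT_mem_evenOdd_zero (L := L) (M := M) β U K)
    (isNilpotent_hubbardInteractionCT (L := L) (M := M) β U K)
  rw [← hC, ← hVK, ← effPartitionFn_eq_gaussExpect] at hdy
  -- solve for `Σ̂`
  set c : ℂ := ((β * (L : ℝ) ^ 2 : ℝ) : ℂ) with hc
  set N : ℂ := gaussExpect ℂ C (gen ℂ (((k, σ), 0) : HubbardFieldIdx L M) * gen ℂ (((k, σ), 1) : HubbardFieldIdx L M) * grassmannExp (-VK))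
    with hNdef
  set Z : ℂ := effPartitionFn ℂ C VK with hZdef
  set S : ℂ := klSelfEnergy L M β U μ K klE0 (nScales β + 1) k σ with hS
  set X : ℂ := gaussExpect ℂ C (grassmannExp (-VK) *
      (grassmannDeriv ℂ (((k, σ), 0) : HubbardFieldIdx L M) (grassmannDeriv ℂ (((k, σ), 1) : HubbardFieldIdx L M) VK) -
        grassmannDeriv ℂ (((k, σ), 0) : HubbardFieldIdx L M) VK * grassmannDeriv ℂ (((k, σ), 1) : HubbardFieldIdx L M) VK)) with hX
  -- `hred : c ĝ² S = N/Z + c ĝ`, `hdy : N + c ĝ Z = −(c ĝ)² X`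
  have h1 : c * propCT L M β μ K k ^ 2 * S * Z = N + c * propCT L M β μ K k * Z := by
    rw [hred]; field_simp
  rw [hdy] at h1
  -- `c ĝ² S Z = −(cĝ)² X` ⇒ `S = −(c/Z) X`
  have h2 : S * Z = -(c * X) := by
    have := h1
    have hcg : c * propCT L M β μ K k ^ 2 ≠ 0 := mul_ne_zero hβL (pow_ne_zero 2 hg0)
    apply mul_left_cancel₀ hcg
    linear_combination this
  field_simp
  linear_combination h2

end Summit.HubbardSuperconductivity.HubbardSuperconductivity.Theorems.TwoPointAssembly

end
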